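import Summits.ValiantsHypothesis.ValiantsHypothesis.Theses.ValuativeGCT

/-! Scratch (refuter drefute 12626 / adjugate-pfaffian-kernel): Lean-level instance checks of the
lead's def-free stubs at small `m`. -/

open Literature.NumberTheory.DiophantineGeometry Literature.Computability.AlgebraicComplexity
open MvPolynomial
open scoped BigOperators Matrix

namespace DrefuteScratch

/-- sums over `MatIdx 2 = Fin 2 ×ₗ Fin 2`, expanded. -/
theorem sum_matIdx_two {N : Type*} [AddCommMonoid N] (f : MatIdx 2 → N) :
    ∑ l : MatIdx 2, f l = f (toLex (0, 0)) + f (toLex (0, 1)) + (f (toLex (1, 0)) + f (toLex (1, 1))) := by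
  rw [← Equiv.sum_comp (toLex : Fin 2 × Fin 2 ≃ Lex (Fin 2 × Fin 2)) f, Fintype.sum_prod_type]
  simp [Fin.sum_univ_two]

/-- Stub 5 at `m = 0`: the witness is `1`, homogeneous of degree `0 * (0 - 1) = 0`. -/
example : (Matrix.det (∑ k : Fin 0, (Matrix.of fun a b : Fin 0 =>
        (X (toLex (k, k), toLex (a, b)) : MvPolynomial (MatIdx 0 × MatIdx 0) ℂ)).adjugateᵀ)).IsHomogeneous
      (0 * (0 - 1)) := by
  simp only [Finset.univ_eq_empty, Finset.sum_empty]
  rw [Matrix.det_isEmpty]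
  exact isHomogeneous_one _ _

/-- Stub 5 at `m = 1`: adjugate of a `1 × 1` matrix is `1`, the witness is `det 1 = 1`, degree `1 * 0 = 0`. -/
example : (Matrix.det (∑ k : Fin 1, (Matrix.of fun a b : Fin 1 =>
        (X (toLex (k, k), toLex (a, b)) : MvPolynomial (MatIdx 1 × MatIdx 1) ℂ)).adjugateᵀ)).IsHomogeneous
      (1 * (1 - 1)) := by
  simp only [Finset.univ_unique, Finset.sum_singleton, Matrix.adjugate_fin_one, Matrix.transpose_one,
    Matrix.det_one]
  exact isHomogeneous_one _ _

/-- The `4 × 4` matrix `M` of the sandwich `T_M Y = P Y` with `P = [[1,1],[0,1]]` (`det P = 1`), in the tree's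
convention `(T_M Y)_(a,b) = Σ_l M l (a,b) • Y_l`: `M (c,d) (a,b) = P a c · δ_{d b}`. Non-symmetric. -/
def P2 : Matrix (Fin 2) (Fin 2) ℂ := !![1, 1; 0, 1]

def Msand : Matrix (MatIdx 2) (MatIdx 2) ℂ :=
  Matrix.of fun l i => if (ofLex l).2 = (ofLex i).2 then P2 (ofLex i).1 (ofLex l).1 else 0

/-- `M ∈ Stab(det₂)`: `linSubst M det₂ = det₂` (the hypothesis `hM` of Stubs 2/3). -/
example : linSubst (MatIdx 2) ℂ Msand (detFormLex ℂ 2) = detFormLex ℂ 2 := by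
  simp only [detFormLex, detPoly, AlgHom.map_det]
  rw [Matrix.det_fin_two, Matrix.det_fin_two]
  simp [Matrix.mvPolynomialX, linSubst_X, sum_matIdx_two, Msand, P2, Matrix.of_apply]
  ring

/-- **Stub 2 (def-free, lead's statement) at `m = 2` for this `M`**: the cofactor chain rule
`Σ_l M (a,b) l • cof(T_M Y)_l = cof(Y)_(a,b)` holds — kernel-level certificate of the index conventions
(outer factor `M (toLex (a,b)) l`, inner `M l' (toLex (a',b'))`, `cof = adjugateᵀ`). -/
example :
    (Matrix.of fun a b : Fin 2 => ∑ l : MatIdx 2, Msand (toLex (a, b)) l •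
        (Matrix.of fun a' b' : Fin 2 => ∑ l' : MatIdx 2, Msand l' (toLex (a', b')) •
          (X l' : MvPolynomial (MatIdx 2) ℂ)).adjugateᵀ (ofLex l).1 (ofLex l).2)
      = (Matrix.of fun a b : Fin 2 => (X (toLex (a, b)) : MvPolynomial (MatIdx 2) ℂ)).adjugateᵀ := by
  ext a b
  fin_cases a <;> fin_cases b <;>
    simp [Matrix.adjugate_fin_two, Matrix.transpose_apply, Matrix.of_apply, sum_matIdx_two, Msand, P2]

/-- Stub 3's conclusion for this `M`: `linSubst Mᵀ det₂ = det₂` (`T_{Mᵀ} Z = Pᵀ Z`). -/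
example : linSubst (MatIdx 2) ℂ Msandᵀ (detFormLex ℂ 2) = detFormLex ℂ 2 := by
  simp only [detFormLex, detPoly, AlgHom.map_det]
  rw [Matrix.det_fin_two, Matrix.det_fin_two]
  simp [Matrix.mvPolynomialX, linSubst_X, sum_matIdx_two, Msand, P2, Matrix.of_apply, Matrix.transpose_apply]
  ring

end DrefuteScratch

namespace DrefuteScratch2
open DrefuteScratch

/-- **Stub 4 (def-free) at `m = 2` for the non-symmetric `Msand`**: the crux's right action
`X (j,i) ↦ Σ_l M l i • X (j,l)` fixes `W_2 = det (cof X_(0,0) + cof X_(1,1))`. -/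
example :
    MvPolynomial.aeval (R := ℂ)
        (fun p : MatIdx 2 × MatIdx 2 => ∑ l : MatIdx 2, Msand l p.2 • (X (p.1, l) : MvPolynomial (MatIdx 2 × MatIdx 2) ℂ))
        (Matrix.det (∑ k : Fin 2, (Matrix.of fun a b : Fin 2 =>
          (X (toLex (k, k), toLex (a, b)) : MvPolynomial (MatIdx 2 × MatIdx 2) ℂ)).adjugateᵀ))
      = Matrix.det (∑ k : Fin 2, (Matrix.of fun a b : Fin 2 =>
          (X (toLex (k, k), toLex (a, b)) : MvPolynomial (MatIdx 2 × MatIdx 2) ℂ)).adjugateᵀ) := by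
  simp only [Fin.sum_univ_two]
  rw [Matrix.det_fin_two]
  simp [Matrix.adjugate_fin_two, Matrix.add_apply, Matrix.transpose_apply, Matrix.of_apply, sum_matIdx_two,
    Msand, P2]
  ring

end DrefuteScratch2

/-! ### Second Frobenius component at `m = 2`: `T_M Y = P Yᵀ` -/
namespace DrefuteScratch3
open DrefuteScratch

/-- `M` of the TRANSPOSED sandwich `T_M Y = P Yᵀ`, `P = [[1,1],[0,1]]`: coefficient of `Y_(l1,l2)` in
`(P Yᵀ)_(a,b) = Σ_c P a c · Y b c` is `[l1 = b] · P a l2`. -/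
def Mtr : Matrix (MatIdx 2) (MatIdx 2) ℂ :=
  Matrix.of fun l i => if (ofLex l).1 = (ofLex i).2 then P2 (ofLex i).1 (ofLex l).2 else 0

example : linSubst (MatIdx 2) ℂ Mtr (detFormLex ℂ 2) = detFormLex ℂ 2 := by
  simp only [detFormLex, detPoly, AlgHom.map_det]
  rw [Matrix.det_fin_two, Matrix.det_fin_two]
  simp [Matrix.mvPolynomialX, linSubst_X, sum_matIdx_two, Mtr, P2, Matrix.of_apply]
  ring

/-- Stub 2 verbatim at `m = 2` for the transposed-sandwich `Mtr`. -/
example :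
    (Matrix.of fun a b : Fin 2 => ∑ l : MatIdx 2, Mtr (toLex (a, b)) l •
        (Matrix.of fun a' b' : Fin 2 => ∑ l' : MatIdx 2, Mtr l' (toLex (a', b')) •
          (X l' : MvPolynomial (MatIdx 2) ℂ)).adjugateᵀ (ofLex l).1 (ofLex l).2)
      = (Matrix.of fun a b : Fin 2 => (X (toLex (a, b)) : MvPolynomial (MatIdx 2) ℂ)).adjugateᵀ := by
  ext a b
  fin_cases a <;> fin_cases b <;>
    simp [Matrix.adjugate_fin_two, Matrix.transpose_apply, Matrix.of_apply, sum_matIdx_two, Mtr, P2]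

/-- Stub 3's conclusion for `Mtr`. -/
example : linSubst (MatIdx 2) ℂ Mtrᵀ (detFormLex ℂ 2) = detFormLex ℂ 2 := by
  simp only [detFormLex, detPoly, AlgHom.map_det]
  rw [Matrix.det_fin_two, Matrix.det_fin_two]
  simp [Matrix.mvPolynomialX, linSubst_X, sum_matIdx_two, Mtr, P2, Matrix.of_apply, Matrix.transpose_apply]
  ring

/-- Stub 4 verbatim at `m = 2` for `Mtr`. -/
example :
    MvPolynomial.aeval (R := ℂ)
        (fun p : MatIdx 2 × MatIdx 2 => ∑ l : MatIdx 2, Mtr l p.2 • (X (p.1, l) : MvPolynomial (MatIdx 2 × MatIdx 2) ℂ))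
        (Matrix.det (∑ k : Fin 2, (Matrix.of fun a b : Fin 2 =>
          (X (toLex (k, k), toLex (a, b)) : MvPolynomial (MatIdx 2 × MatIdx 2) ℂ)).adjugateᵀ))
      = Matrix.det (∑ k : Fin 2, (Matrix.of fun a b : Fin 2 =>
          (X (toLex (k, k), toLex (a, b)) : MvPolynomial (MatIdx 2 × MatIdx 2) ℂ)).adjugateᵀ) := by
  simp only [Fin.sum_univ_two]
  rw [Matrix.det_fin_two]
  simp [Matrix.adjugate_fin_two, Matrix.add_apply, Matrix.transpose_apply, Matrix.of_apply, sum_matIdx_two,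
    Mtr, P2]
  ring

end DrefuteScratch3

/-! ### `m = 3` (cofactors are quadrics): sandwich `T_M Y = P Y`, `P = 1 + E_01` -/
namespace DrefuteScratch4

theorem sum_matIdx_three {N : Type*} [AddCommMonoid N] (f : MatIdx 3 → N) :
    ∑ l : MatIdx 3, f l = f (toLex (0, 0)) + f (toLex (0, 1)) + f (toLex (0, 2))
      + (f (toLex (1, 0)) + f (toLex (1, 1)) + f (toLex (1, 2)))
      + (f (toLex (2, 0)) + f (toLex (2, 1)) + f (toLex (2, 2))) := by
  rw [← Equiv.sum_comp (toLex : Fin 3 × Fin 3 ≃ Lex (Fin 3 × Fin 3)) f, Fintype.sum_prod_type]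
  simp [Fin.sum_univ_three]

def P3 : Matrix (Fin 3) (Fin 3) ℂ := !![1, 1, 0; 0, 1, 0; 0, 0, 1]

/-- `M (c,d) (a,b) = P a c · δ_{db}` (`T_M Y = P Y`). -/
def Ms3 : Matrix (MatIdx 3) (MatIdx 3) ℂ :=
  Matrix.of fun l i => if (ofLex l).2 = (ofLex i).2 then P3 (ofLex i).1 (ofLex l).1 else 0

example : linSubst (MatIdx 3) ℂ Ms3 (detFormLex ℂ 3) = detFormLex ℂ 3 := by
  simp only [detFormLex, detPoly, AlgHom.map_det]
  rw [Matrix.det_fin_three, Matrix.det_fin_three]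
  simp [Matrix.mvPolynomialX, linSubst_X, sum_matIdx_three, Ms3, P3, Matrix.of_apply]
  ring

/-- Stub 2 verbatim at `m = 3` for `Ms3` (quadratic cofactors). -/
example :
    (Matrix.of fun a b : Fin 3 => ∑ l : MatIdx 3, Ms3 (toLex (a, b)) l •
        (Matrix.of fun a' b' : Fin 3 => ∑ l' : MatIdx 3, Ms3 l' (toLex (a', b')) •
          (X l' : MvPolynomial (MatIdx 3) ℂ)).adjugateᵀ (ofLex l).1 (ofLex l).2)
      = (Matrix.of fun a b : Fin 3 => (X (toLex (a, b)) : MvPolynomial (MatIdx 3) ℂ)).adjugateᵀ := by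
  apply Matrix.ext
  intro a b
  fin_cases a <;> fin_cases b <;>
    simp [Matrix.adjugate_fin_three, Matrix.transpose_apply, Matrix.of_apply, sum_matIdx_three, Ms3, P3] <;> ring

end DrefuteScratch4
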